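import Summits.SmoothPoincare4.SmoothPoincare4.Theorems.SullivanDualRelativeSullivanDualityTame
import HarnessLib

/-!
# Route `SullivanDual`, crux `HyperbolicEnd` (stmt-SmoothPoincare4-7825), line `taubes-circle-pencil`:
# uniform domination of a `1`-form by a taming `2`-form on a compact set
# (registered helper `helper_sq_oneForm_le_mul_tame`)

For a `4`-manifold `N`, a field of endomorphisms `J` smooth in tangent coordinates, a smooth
`1`-form `λ` and a smooth `2`-form `α` taming `J` at every point of a compact set `K`
(`α_x(v, J_x v) > 0` for `v ≠ 0`, `x ∈ K`), there is a constant `M ≥ 0` with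
`λ_x(v)² ≤ M · α_x(v, J_x v)` for all `x ∈ K` and all `v` ("`λ` is bounded and the taming is
uniform on `K`", stated intrinsically: both sides are quadratic in `v`, so no metric is needed).
Proof: read `λ`, `α`, `J` in the trivialisation at `x₀ ∈ K` (`form_apply_eq_inChart` of
`SullivanDualRelativeSullivanDualityTame` and its `1`-form analogue `oneForm_apply_eq_inChart`),
where they are continuous at `x₀`; a positive minimum of `u ↦ α̂(x₀)(u, Ĵ(x₀)u)` on the unit sphere
and operator-norm estimates give the bound near `x₀` (`exists_nhds_sq_oneForm_le`), and
`IsCompact.induction_on` globalises.  This is the input "taming uniform on the compact core,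
primitive bounded there" of the registered stub `stub_noWitnessOffDefect` (S2).  No named facts.
-/

-- the registered namespace `Summit.SmoothPoincare4.SmoothPoincare4.…` repeats a component (P = Sub)
set_option linter.dupNamespace false

noncomputable section

open scoped Manifold ContDiff Topology
open Set Filter Literature.Geometry.Kaehler
open Summit.SmoothPoincare4.SmoothPoincare4.Theorems

namespace Summit.SmoothPoincare4.SmoothPoincare4.Cruxes.HyperbolicEnd.TaubesCirclePencil

variable {N : Type*} [TopologicalSpace N] [ChartedSpace (EuclideanSpace ℝ (Fin 4)) N]
  [IsManifold (𝓡 4) ∞ N]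

/-- Operator-norm bound for a continuous alternating `1`-form: `|L(u)| ≤ ‖L‖ ‖u‖`. [folklore] -/
theorem norm_oneForm_apply_le (L : EuclideanSpace ℝ (Fin 4) [⋀^Fin 1]→L[ℝ] ℝ)
    (u : EuclideanSpace ℝ (Fin 4)) : ‖L ![u]‖ ≤ ‖L‖ * ‖u‖ := by
  have h := L.le_opNorm ![u]
  simpa using h

/-- Homogeneity of a `1`-form: `L(c u) = c L(u)`. [folklore] -/
theorem oneForm_apply_smul (L : EuclideanSpace ℝ (Fin 4) [⋀^Fin 1]→L[ℝ] ℝ) (c : ℝ)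
    (u : EuclideanSpace ℝ (Fin 4)) : L ![c • u] = c * L ![u] := by
  have h := L.toContinuousMultilinearMap.map_smul_univ (fun _ => c) ![u]
  have e : (fun i => (fun _ : Fin 1 => c) i • ![u] i) = ![c • u] := by
    funext i
    fin_cases i; simp
  rw [e] at h
  simpa using h

/-- **Chart identity for `1`-forms.** For `x` in the chart source of `x₀` and `v ∈ T_x N`:
`λ_x(v) = λ̂(e x)(P v)` with `e = extChartAt x₀`, `λ̂ = λ.inChart x₀`, `P = De(x)`
(Warner 1983, §2.18; companion of `form_apply_eq_inChart`). [folklore] -/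
theorem oneForm_apply_eq_inChart (x₀ : N) {x : N}
    (hx : x ∈ (chartAt (EuclideanSpace ℝ (Fin 4)) x₀).source)
    (lam : MForm (𝓡 4) N ℝ 1) (v : TangentSpace (𝓡 4) x) :
    lam x ![v] = lam.inChart x₀ (extChartAt (𝓡 4) x₀ x)
      ![mfderiv (𝓡 4) 𝓘(ℝ, EuclideanSpace ℝ (Fin 4)) (extChartAt (𝓡 4) x₀) x v] := by
  have hxe : x ∈ (extChartAt (𝓡 4) x₀).source := by rwa [extChartAt_source]
  rw [MForm.inChart_apply]
  have hPinvP : ∀ w, mfderivWithin 𝓘(ℝ, EuclideanSpace ℝ (Fin 4)) (𝓡 4) (extChartAt (𝓡 4) x₀).symm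
      (range (𝓡 4)) (extChartAt (𝓡 4) x₀ x)
      (mfderiv (𝓡 4) 𝓘(ℝ, EuclideanSpace ℝ (Fin 4)) (extChartAt (𝓡 4) x₀) x w) = w := fun w => by
    have h := mfderivWithin_extChartAt_symm_comp_mfderiv_extChartAt' (I := 𝓡 4) hxe
    exact DFunLike.congr_fun h w
  have hleft : (extChartAt (𝓡 4) x₀).symm (extChartAt (𝓡 4) x₀ x) = x :=
    (extChartAt (𝓡 4) x₀).left_inv hxe
  have key : ∀ (y : N) (_ : y = x) (m : Fin 1 → EuclideanSpace ℝ (Fin 4)), lam y m = lam x m := by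
    rintro y rfl m
    rfl
  rw [key _ hleft]
  congr 1
  funext i
  fin_cases i
  simp only [Fin.zero_eta, Fin.isValue, Matrix.cons_val_fin_one]
  exact (hPinvP v).symm

/-- **Local domination.** If `α_{x₀}(v, J_{x₀} v) > 0` for `v ≠ 0`, with `λ`, `α` smooth forms
and `J` smooth at `x₀` in the trivialisation at `x₀`, then on a neighbourhood `U` of `x₀`:
`0 ≤ α_x(v, J_x v)` and `λ_x(v)² ≤ M · α_x(v, J_x v)` for some `M ≥ 0`.  Read everything in the
chart at `x₀`; `u ↦ α̂(x₀)(u, Ĵ(x₀)u)` has a positive minimum `m` on the unit sphere, so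
`α̂(x)(u, Ĵ(x)u) ≥ m/2` and `|λ̂(x)(u)| ≤ ‖λ̂(x₀)‖ + 1` nearby; conclude by homogeneity.
[folklore] -/
theorem exists_nhds_sq_oneForm_le (x₀ : N) {lam : MForm (𝓡 4) N ℝ 1} {α : MForm (𝓡 4) N ℝ 2}
    (hlam : IsSmoothForm lam) (hα : IsSmoothForm α)
    (J : ∀ y : N, TangentSpace (𝓡 4) y →L[ℝ] TangentSpace (𝓡 4) y)
    (hJ : ContMDiffAt (𝓡 4) 𝓘(ℝ, EuclideanSpace ℝ (Fin 4) →L[ℝ] EuclideanSpace ℝ (Fin 4)) ∞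
      (inTangentCoordinates (𝓡 4) (𝓡 4) (id : N → N) id (fun y => J y) x₀) x₀)
    (hpos : ∀ v : TangentSpace (𝓡 4) x₀, v ≠ 0 → 0 < α x₀ ![v, J x₀ v]) :
    ∃ U ∈ 𝓝 x₀, ∃ M : ℝ, 0 ≤ M ∧ ∀ x ∈ U, ∀ v : TangentSpace (𝓡 4) x,
      0 ≤ α x ![v, J x v] ∧ (lam x ![v]) ^ 2 ≤ M * α x ![v, J x v] := by
  -- chart data at `x₀`
  set Jh : N → EuclideanSpace ℝ (Fin 4) →L[ℝ] EuclideanSpace ℝ (Fin 4) :=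
    inTangentCoordinates (𝓡 4) (𝓡 4) (id : N → N) id (fun y => J y) x₀ with hJh_def
  set Qh : N → EuclideanSpace ℝ (Fin 4) [⋀^Fin 2]→L[ℝ] ℝ :=
    fun x => α.inChart x₀ (extChartAt (𝓡 4) x₀ x) with hQh_def
  set Lh : N → EuclideanSpace ℝ (Fin 4) [⋀^Fin 1]→L[ℝ] ℝ :=
    fun x => lam.inChart x₀ (extChartAt (𝓡 4) x₀ x) with hLh_def
  -- continuity at `x₀`
  have hr : range (𝓡 4) = (univ : Set (EuclideanSpace ℝ (Fin 4))) :=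
    ModelWithCorners.Boundaryless.range_eq_univ
  have hQc : ContinuousAt Qh x₀ := by
    have h1 : ContinuousAt (α.inChart x₀) (extChartAt (𝓡 4) x₀ x₀) := by
      have h := (hα x₀).continuousWithinAt
      rwa [hr, continuousWithinAt_univ] at h
    exact h1.comp (continuousAt_extChartAt x₀)
  have hLc : ContinuousAt Lh x₀ := by
    have h1 : ContinuousAt (lam.inChart x₀) (extChartAt (𝓡 4) x₀ x₀) := by
      have h := (hlam x₀).continuousWithinAt
      rwa [hr, continuousWithinAt_univ] at h
    exact h1.comp (continuousAt_extChartAt x₀)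
  have hJc : ContinuousAt Jh x₀ := hJ.continuousAt
  -- the chart identities
  have hident2 : ∀ (x : N), x ∈ (chartAt (EuclideanSpace ℝ (Fin 4)) x₀).source →
      ∀ v : TangentSpace (𝓡 4) x, α x ![v, J x v] =
        Qh x ![mfderiv (𝓡 4) 𝓘(ℝ, EuclideanSpace ℝ (Fin 4)) (extChartAt (𝓡 4) x₀) x v,
            Jh x (mfderiv (𝓡 4) 𝓘(ℝ, EuclideanSpace ℝ (Fin 4)) (extChartAt (𝓡 4) x₀) x v)] :=
    fun x hx v => form_apply_eq_inChart x₀ hx α J v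
  have hident1 : ∀ (x : N), x ∈ (chartAt (EuclideanSpace ℝ (Fin 4)) x₀).source →
      ∀ v : TangentSpace (𝓡 4) x, lam x ![v] =
        Lh x ![mfderiv (𝓡 4) 𝓘(ℝ, EuclideanSpace ℝ (Fin 4)) (extChartAt (𝓡 4) x₀) x v] :=
    fun x hx v => oneForm_apply_eq_inChart x₀ hx lam v
  -- at `x₀` the chart identity is the identity
  have hid0 : ∀ u : EuclideanSpace ℝ (Fin 4), Qh x₀ ![u, Jh x₀ u] = α x₀ ![u, J x₀ u] := by
    intro u
    have h := form_apply_eq_inChart x₀ (mem_chart_source _ x₀) α J u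
    rw [mfderiv_extChartAt_self] at h
    exact h.symm
  -- positive minimum on the unit sphere at `x₀`
  set g : EuclideanSpace ℝ (Fin 4) → ℝ := fun u => Qh x₀ ![u, Jh x₀ u] with hg_def
  have hgc : Continuous g := by
    have h1 : Continuous fun u : EuclideanSpace ℝ (Fin 4) => ![u, Jh x₀ u] := by
      refine continuous_pi fun i => ?_
      fin_cases i
      · exact continuous_id
      · exact (Jh x₀).continuous
    exact (Qh x₀).coe_continuous.comp h1
  obtain ⟨u₀, hu₀S, hu₀min⟩ := (isCompact_sphere (0 : EuclideanSpace ℝ (Fin 4)) 1).exists_isMinOn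
    ((NormedSpace.sphere_nonempty).2 zero_le_one) hgc.continuousOn
  set m : ℝ := g u₀ with hm_def
  have hm : 0 < m := by
    have hu₀ : u₀ ≠ 0 := by
      intro h
      rw [h, mem_sphere_zero_iff_norm, norm_zero] at hu₀S
      exact zero_ne_one hu₀S
    rw [hm_def, hg_def]
    simp only
    rw [hid0]
    exact hpos u₀ hu₀
  have hmle : ∀ u : EuclideanSpace ℝ (Fin 4), ‖u‖ = 1 → m ≤ Qh x₀ ![u, Jh x₀ u] := by
    intro u hu
    exact hu₀min (show u ∈ Metric.sphere (0 : EuclideanSpace ℝ (Fin 4)) 1 from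
      mem_sphere_zero_iff_norm.2 hu)
  -- the neighbourhood
  set err : N → ℝ := fun x => ‖Qh x - Qh x₀‖ * ‖Jh x‖ + ‖Qh x₀‖ * ‖Jh x - Jh x₀‖ with herr_def
  set Lb : ℝ := ‖Lh x₀‖ + 1 with hLb_def
  have herrc : ContinuousAt err x₀ :=
    ((hQc.sub continuousAt_const).norm.mul hJc.norm).add
      (continuousAt_const.mul (hJc.sub continuousAt_const).norm)
  have herr0 : err x₀ < m / 2 := by
    simp only [herr_def, sub_self, norm_zero, zero_mul, mul_zero, add_zero]
    linarith
  have hLb0 : ‖Lh x₀‖ < Lb := by simp [hLb_def]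
  have hev1 : ∀ᶠ x in 𝓝 x₀, err x < m / 2 := herrc.eventually_lt continuousAt_const herr0
  have hev2 : ∀ᶠ x in 𝓝 x₀, ‖Lh x‖ < Lb := hLc.norm.eventually_lt continuousAt_const hLb0
  have hev3 : ∀ᶠ x in 𝓝 x₀, x ∈ (chartAt (EuclideanSpace ℝ (Fin 4)) x₀).source :=
    chart_source_mem_nhds _ x₀
  have hLb : 0 < Lb := by
    have : 0 ≤ ‖Lh x₀‖ := norm_nonneg _
    simp only [hLb_def]; linarith
  refine ⟨{x | err x < m / 2 ∧ ‖Lh x‖ < Lb ∧ x ∈ (chartAt (EuclideanSpace ℝ (Fin 4)) x₀).source},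
    (hev1.and (hev2.and hev3)), 2 * Lb ^ 2 / m, by positivity, ?_⟩
  intro x hx v
  obtain ⟨hxerr, hxL, hxs⟩ := hx
  -- estimates on the unit sphere at `x`
  have hunit : ∀ u : EuclideanSpace ℝ (Fin 4), ‖u‖ = 1 →
      m / 2 ≤ Qh x ![u, Jh x u] ∧ (Lh x ![u]) ^ 2 ≤ Lb ^ 2 := by
    intro u hu
    have h1 : |Qh x ![u, Jh x u] - Qh x₀ ![u, Jh x u]| ≤ ‖Qh x - Qh x₀‖ * ‖Jh x‖ := by
      rw [← ContinuousAlternatingMap.sub_apply, ← Real.norm_eq_abs]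
      refine (norm_twoForm_apply_le _ _ _).trans ?_
      rw [hu, one_mul]
      exact mul_le_mul_of_nonneg_left
        ((Jh x).le_opNorm u |>.trans (by rw [hu, mul_one])) (norm_nonneg _)
    have h2 : |Qh x₀ ![u, Jh x u] - Qh x₀ ![u, Jh x₀ u]| ≤ ‖Qh x₀‖ * ‖Jh x - Jh x₀‖ := by
      have esub : Jh x u - Jh x₀ u = (Jh x - Jh x₀) u := rfl
      rw [twoForm_apply_sub_right, ← Real.norm_eq_abs, esub]
      refine (norm_twoForm_apply_le _ _ _).trans ?_
      rw [hu, one_mul]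
      exact mul_le_mul_of_nonneg_left
        ((Jh x - Jh x₀).le_opNorm u |>.trans (by rw [hu, mul_one])) (norm_nonneg _)
    have h4 := hmle u hu
    have h5 : m / 2 ≤ Qh x ![u, Jh x u] := by
      have e : Qh x ![u, Jh x u] = Qh x₀ ![u, Jh x₀ u] +
          ((Qh x ![u, Jh x u] - Qh x₀ ![u, Jh x u]) +
            (Qh x₀ ![u, Jh x u] - Qh x₀ ![u, Jh x₀ u])) := by ring
      rw [e]
      simp only [herr_def] at hxerr
      linarith [abs_le.1 h1, abs_le.1 h2]
    have h6 : |Lh x ![u]| ≤ Lb := by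
      rw [← Real.norm_eq_abs]
      refine (norm_oneForm_apply_le _ _).trans ?_
      rw [hu, mul_one]
      exact hxL.le
    refine ⟨h5, ?_⟩
    have h7 := abs_le.1 h6
    nlinarith
  -- transfer to arbitrary `v` through `P = De(x)` and homogeneity
  set w : EuclideanSpace ℝ (Fin 4) :=
    mfderiv (𝓡 4) 𝓘(ℝ, EuclideanSpace ℝ (Fin 4)) (extChartAt (𝓡 4) x₀) x v with hw
  rw [hident2 x hxs v, hident1 x hxs v]
  change 0 ≤ Qh x ![w, Jh x w] ∧ (Lh x ![w]) ^ 2 ≤ 2 * Lb ^ 2 / m * Qh x ![w, Jh x w]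
  by_cases hw0 : w = 0
  · rw [hw0, map_zero]
    have e1 : Qh x ![(0 : EuclideanSpace ℝ (Fin 4)), 0] = 0 :=
      (Qh x).map_coord_zero (0 : Fin 2) rfl
    have e2 : Lh x ![(0 : EuclideanSpace ℝ (Fin 4))] = 0 :=
      (Lh x).map_coord_zero (0 : Fin 1) rfl
    rw [e1, e2]
    simp
  set u : EuclideanSpace ℝ (Fin 4) := ‖w‖⁻¹ • w with hu_def
  have hwpos : 0 < ‖w‖ := norm_pos_iff.2 hw0
  have hu1 : ‖u‖ = 1 := by
    rw [hu_def, norm_smul, norm_inv, norm_norm, inv_mul_cancel₀ hwpos.ne']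
  have hwu : w = ‖w‖ • u := by
    rw [hu_def, smul_smul, mul_inv_cancel₀ hwpos.ne', one_smul]
  obtain ⟨hQ, hL⟩ := hunit u hu1
  rw [hwu, map_smul, twoForm_apply_smul_smul, oneForm_apply_smul]
  have hsq : 0 < ‖w‖ ^ 2 := by positivity
  refine ⟨by nlinarith, ?_⟩
  have e : 2 * Lb ^ 2 / m * (‖w‖ ^ 2 * Qh x ![u, Jh x u]) =
      ‖w‖ ^ 2 * (2 * Lb ^ 2 / m * Qh x ![u, Jh x u]) := by ring
  rw [mul_pow, e]
  refine mul_le_mul_of_nonneg_left ?_ hsq.le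
  have h8 : Lb ^ 2 ≤ 2 * Lb ^ 2 / m * (m / 2) := by
    field_simp
    exact le_rfl
  calc (Lh x ![u]) ^ 2 ≤ Lb ^ 2 := hL
    _ ≤ 2 * Lb ^ 2 / m * (m / 2) := h8
    _ ≤ 2 * Lb ^ 2 / m * Qh x ![u, Jh x u] :=
        mul_le_mul_of_nonneg_left hQ (by positivity)

-- registered signature, verbatim on one line (gate matches name + header textually)
/-- **Uniform domination of a smooth `1`-form by a taming smooth `2`-form on a compact set.**
If `α` tames `J` at every point of the compact `K` then `λ_x(v)² ≤ M · α_x(v, J_x v)` for all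
`x ∈ K`, `v ∈ T_x N`, for one constant `M ≥ 0` (local version `exists_nhds_sq_oneForm_le` +
`IsCompact.induction_on`).  In the stub `stub_noWitnessOffDefect` this is "the primitive `λ` is
bounded and the taming is uniform on the compact core". [folklore] -/
theorem helper_sq_oneForm_le_mul_tame : ∀ {N : Type} [TopologicalSpace N] [ChartedSpace (EuclideanSpace ℝ (Fin 4)) N] [IsManifold (𝓡 4) ∞ N] (K : Set N) (lam : MForm (𝓡 4) N ℝ 1) (α : MForm (𝓡 4) N ℝ 2) (J : ∀ y : N, TangentSpace (𝓡 4) y →L[ℝ] TangentSpace (𝓡 4) y), IsCompact K → IsSmoothForm lam → IsSmoothForm α → (∀ x₀ : N, ContMDiffAt (𝓡 4) 𝓘(ℝ, EuclideanSpace ℝ (Fin 4) →L[ℝ] EuclideanSpace ℝ (Fin 4)) ∞ (inTangentCoordinates (𝓡 4) (𝓡 4) (id : N → N) id (fun y => J y) x₀) x₀) → (∀ x ∈ K, ∀ v : TangentSpace (𝓡 4) x, v ≠ 0 → 0 < α x ![v, J x v]) → ∃ M : ℝ, 0 ≤ M ∧ ∀ x ∈ K, ∀ v : TangentSpace (𝓡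 4) x, (lam x ![v]) ^ 2 ≤ M * α x ![v, J x v] := by
  intro N _ _ _ K lam α J hK hlam hα hJ hpos
  suffices h : ∃ M : ℝ, 0 ≤ M ∧ ∀ x ∈ K, ∀ v : TangentSpace (𝓡 4) x,
      0 ≤ α x ![v, J x v] ∧ (lam x ![v]) ^ 2 ≤ M * α x ![v, J x v] by
    obtain ⟨M, hM, h⟩ := h
    exact ⟨M, hM, fun x hx v => (h x hx v).2⟩
  refine hK.induction_on
    (p := fun S => ∃ M : ℝ, 0 ≤ M ∧ ∀ x ∈ S, ∀ v : TangentSpace (𝓡 4) x,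
      0 ≤ α x ![v, J x v] ∧ (lam x ![v]) ^ 2 ≤ M * α x ![v, J x v]) ?_ ?_ ?_ ?_
  · exact ⟨0, le_rfl, fun x hx => (Set.notMem_empty x hx).elim⟩
  · rintro S T hST ⟨M, hM, h⟩
    exact ⟨M, hM, fun x hx => h x (hST hx)⟩
  · rintro S T ⟨M₁, hM₁, h₁⟩ ⟨M₂, hM₂, h₂⟩
    refine ⟨max M₁ M₂, le_max_of_le_left hM₁, fun x hx v => ?_⟩
    rcases hx with hx | hx
    · obtain ⟨h0, h⟩ := h₁ x hx v
      exact ⟨h0, h.trans (mul_le_mul_of_nonneg_right (le_max_left _ _) h0)⟩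
    · obtain ⟨h0, h⟩ := h₂ x hx v
      exact ⟨h0, h.trans (mul_le_mul_of_nonneg_right (le_max_right _ _) h0)⟩
  · intro x₀ hx₀
    obtain ⟨U, hU, M, hM, h⟩ := exists_nhds_sq_oneForm_le x₀ hlam hα J (hJ x₀) (hpos x₀ hx₀)
    exact ⟨U, mem_nhdsWithin_of_mem_nhds hU, M, hM, h⟩

end Summit.SmoothPoincare4.SmoothPoincare4.Cruxes.HyperbolicEnd.TaubesCirclePencil

end
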